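import Literature.Computability.Cryptography.QuantumCircuit
import Literature.Computability.QuantumComplexity.RevUncompute
import Literature.Computability.Complexity.TM2Iterate
import HarnessLib

/-!
# Classical wrapping inside quantum search, I: layout, read-out profile, the wrapped post-processor

Trunk `CryptoQuantFine`; first file of the construction discharging the named fact
`Literature.Computability.Cryptography.isQSolvable_classicalWrap` (`Cryptography/ShorProofs.lean`:
classical pre- and post-processing `h, g ∈ FP` around a bounded-error quantum search family —
"deterministic polynomial-time computation is free inside `BQP`", Bernstein–Vazirani 1997,
§8; Nielsen–Chuang 2010, §3.2.5, §4.5.5). The wrapped family, on an input `x` of length `n`,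
(1) computes `h x` by the garbage-free block of `RevUncompute.lean` at its canonical position
(data wires `0 … n-1`, work wires after), (2) raises one-hot *length flags* `e_ℓ = [|h x| = ℓ]`,
`ℓ ≤ L(n)`, from the emptiness wires of that block (`RevMultiplex.lean`), (3) routes `h x` into
the input wires of *block* `ℓ = |h x|` among `L(n)+1` equal blocks of width `Pw(n)`, (4) runs,
for every `ℓ`, the given circuit `F.circ ℓ` on block `ℓ` (conjugated onto the front wires, so
that its description is printed verbatim), (5) computes the wrapped post-processor
`gWrap g` — which parses `x`, the live length and the live block out of the whole prefix — by a
second garbage-free block whose data wires are *all* wires so far, and (6) swaps its output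
bits to the front. This file fixes the **layout** (all sizes are explicit functions of `n`),
proves the **read-out profile** of a garbage-free block (emptiness wire `j` reads
`[|out| ≤ j]`, the `true`-code wire `j < |out|` reads `out[j]`, also when `true` is not a
reachable symbol), and defines **`gWrap`** with its defining equation on well-formed inputs.

## References

* E. Bernstein, U. Vazirani, *Quantum complexity theory*, SIAM J. Comput. 26 (1997), §8
  (`BQP^BQP = BQP`; classical computation inside quantum machines).
* M. A. Nielsen, I. L. Chuang, *Quantum Computation and Quantum Information*, CUP 2010,
  §3.2.5 (garbage-free reversible computation), §4.5.5.
* S. Arora, B. Barak, *Computational Complexity: A Modern Approach*, CUP 2009, §6.2 (one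
  circuit per input length, hard-wired).
-/

noncomputable section

namespace Literature.Computability.QuantumComplexity

namespace CWrap

open _root_.Computability Complexity Complexity.FinTM2Sim Turing Function RevSim RevClean Cryptography

/-! ### Read-out profile of a garbage-free block -/

section Profile

variable {e : ℕ} {M : TM2ComputableAux Bool Bool}

/-- The code of `true` on the output stack, restricted to the reachable alphabet (`none`, i.e.
the empty-cell code, if `true` is not reachable — then no output word contains `true`).
[folklore] -/
def symTrue (M : TM2ComputableAux Bool Bool) : Option (StackSym M.tm M.tm.k₁) :=
  toSym M.tm M.tm.k₁ (M.outputAlphabet.symm true)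

/-- **The emptiness wire reads `[|out| ≤ j]`.** [folklore] -/
theorem outBit_none_eq {n : ℕ} {u l' : List Bool} (hu : u.length = n) (hM : M.OutputsWithin u l' (Tn e n)) (j : ℕ) :
    outBit M l' j none = decide (l'.length ≤ j) := by
  classical
  obtain ⟨-, hgood⟩ := length_lt_JJ_of_outputsWithin (e := e) hu hM
  unfold outBit
  by_cases hj : j < l'.length
  · obtain ⟨h, hc⟩ := cellVal_haltList_of_lt hgood hj
    rw [hc]
    simp [Nat.not_le.2 hj]
  · rw [cellVal_haltList_of_le (Nat.not_lt.1 hj)]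
    simp [Nat.not_lt.1 hj]

/-- **The `true`-code wire of a cell inside the output word reads that bit** (if `true` is not
reachable, the bit is `false` and so is the wire, which then is the emptiness wire of a full
cell). [folklore] -/
theorem outBit_symTrue_eq {n : ℕ} {u l' : List Bool} (hu : u.length = n) (hM : M.OutputsWithin u l' (Tn e n))
    {j : ℕ} (hj : j < l'.length) : outBit M l' j (symTrue M) = l'[j] := by
  classical
  obtain ⟨-, hgood⟩ := length_lt_JJ_of_outputsWithin (e := e) hu hM
  unfold outBit
  obtain ⟨h, hc⟩ := cellVal_haltList_of_lt hgood hj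
  rw [hc]
  generalize hb : l'[j] = b at h
  cases b with
  | true =>
    rw [symTrue, toSym_of_isSym _ h]
    simp
  | false =>
    rw [decide_eq_false_iff_not]
    intro heq
    unfold symTrue toSym at heq
    split_ifs at heq with h'
    · simp only [Option.some.injEq] at heq
      have hval := congrArg Subtype.val heq
      exact absurd (M.outputAlphabet.symm.injective hval) (by simp)

/-- Outside the result wires the read-out is `0`: below the tableau bound … [folklore] -/
theorem readOut_of_lt_NN {n : ℕ} (l' : List Bool) {i : ℕ} (hi : i < NN e M n) : readOut e M n l' i = false := by
  unfold readOut
  rw [if_neg (fun h => absurd h.1 (Nat.not_le.2 hi))]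

/-- … and from the width on. [folklore] -/
theorem readOut_of_width_le {n : ℕ} (l' : List Bool) {i : ℕ} (hi : width e M n ≤ i) : readOut e M n l' i = false := by
  unfold readOut
  rw [if_neg (fun h => absurd h.2 (Nat.not_lt.2 (by unfold width copyN at hi; exact hi)))]

/-- **The garbage-free block with empty constant suffix**, run on the string `x` followed by
zeros: data kept, work wires holding the read-out of the output word. [cite: Shor1997, §3 p.8 (compute F(x) keeping x, copy, undo)] -/
theorem clEval_cleanOps_nil (x l' : List Bool) (hM : M.OutputsWithin x l' (Tn e x.length)) :
    clEval (cleanOps e M x.length []) (strW x) =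
      fun i => if i < x.length then x.getD i false else readOut e M x.length l' i := by
  have h := clEval_cleanOps (e := e) (M := M) x [] l' (by simpa using hM)
  simpa using h

/-- After the block, the emptiness wire `j < JJ` reads `[|out| ≤ j]`. [folklore] -/
theorem clEval_cleanOps_nil_none (x l' : List Bool) (hM : M.OutputsWithin x l' (Tn e x.length)) {j : ℕ} (hj : j < JJ e M x.length) :
    clEval (cleanOps e M x.length []) (strW x) (resW e M x.length j none) = decide (l'.length ≤ j) := by
  rw [clEval_cleanOps_nil x l' hM]
  have hge : ¬ resW e M x.length j none < x.length :=
    Nat.not_lt.2 ((le_NN (e := e) (M := M) x.length).trans (NN_le_resW _ _ _))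
  simp only [hge, if_false]
  rw [readOut_resW hj, outBit_none_eq rfl hM]

/-- After the block, the `true`-code wire of a cell `j < |out|` reads `out[j]`. [folklore] -/
theorem clEval_cleanOps_nil_symTrue (x l' : List Bool) (hM : M.OutputsWithin x l' (Tn e x.length)) {j : ℕ} (hj : j < l'.length) :
    clEval (cleanOps e M x.length []) (strW x) (resW e M x.length j (symTrue M)) = l'[j] := by
  have hJ : j < JJ e M x.length := lt_trans hj (length_lt_JJ_of_outputsWithin (e := e) rfl hM).1
  rw [clEval_cleanOps_nil x l' hM]
  have hge : ¬ resW e M x.length j (symTrue M) < x.length :=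
    Nat.not_lt.2 ((le_NN (e := e) (M := M) x.length).trans (NN_le_resW _ _ _))
  simp only [hge, if_false]
  rw [readOut_resW hJ, outBit_symTrue_eq rfl hM hj]

/-- The capacity bound: `JJ ≤ NN` (the represented cells fit below the tableau bound, since a
layer holds `(S + d) · CW ≥ S + d` cell wires). [folklore] -/
theorem JJ_le_NN (n : ℕ) : JJ e M n ≤ NN e M n := by
  have h1 := one_le_CW M.tm
  have h2 : JJ e M n ≤ LW M.tm e n := by
    unfold JJ LW
    calc Sn M.tm e n + dd M.tm ≤ (Sn M.tm e n + dd M.tm) * CW M.tm := Nat.le_mul_of_pos_right _ h1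
      _ ≤ nC M.tm + (Sn M.tm e n + dd M.tm) * CW M.tm := Nat.le_add_left _ _
  rw [NN_eq]
  unfold ansW LB
  omega

end Profile

/-! ### Layout -/

/-- Layout data (a hypothesis structure): the pre-processor `h` with a machine computing it
within `(n+2)^eh` steps (`RevClean.exists_outputsWithin_pow_of_mem_FP`), the family being
wrapped, and a polynomial bound on its ancilla count (`QCircuitFamily.IsUniform.isPolySize`).
[folklore] -/
structure Layout where
  /-- the pre-processor -/
  h : List Bool → List Bool
  /-- time exponent of the pre-processor machine -/
  eh : ℕ
  /-- the pre-processor machine -/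
  Mh : TM2ComputableAux Bool Bool
  /-- it computes `h` within `(n+2)^eh` steps -/
  hMh : ∀ u, Mh.OutputsWithin u (h u) (Tn eh u.length)
  /-- the family being wrapped -/
  F : QCircuitFamily cliffordT
  /-- a polynomial … -/
  pF : Polynomial ℕ
  /-- … bounding the ancilla count -/
  hpF : ∀ m, F.ancillas m ≤ pF.eval m

variable (Q : Layout)

/-- The largest possible length `L(n) = JJ - 1` of `h x` (`|h x| < JJ`). [folklore] -/
def Lh (n : ℕ) : ℕ := JJ Q.eh Q.Mh n - 1

/-- The width of the block of `h` (data, tableau, result wires). [folklore] -/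
def widthH (n : ℕ) : ℕ := RevClean.width Q.eh Q.Mh n

/-- The flag wires, right after the block of `h`. [folklore] -/
def flagW (n ℓ : ℕ) : ℕ := widthH Q n + ℓ

/-- The common width of the blocks: room for `ℓ + F.ancillas ℓ` wires for every `ℓ ≤ L(n)`.
[folklore] -/
def Pw (n : ℕ) : ℕ := Lh Q n + Q.pF.eval (Lh Q n)

/-- The base of the blocks: beyond the flags and beyond the front window `[0, Pw)` onto which
the blocks are swapped. [folklore] -/
def baseB (n : ℕ) : ℕ := widthH Q n + (Lh Q n + 1) + Pw Q n

/-- Wire `i` of block `ℓ`. [folklore] -/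
def blockW (n ℓ i : ℕ) : ℕ := baseB Q n + ℓ * Pw Q n + i

/-- The number of data wires of the block of the post-processor: everything so far. [folklore] -/
def D (n : ℕ) : ℕ := baseB Q n + (Lh Q n + 1) * Pw Q n

/-- The constant suffix written behind the data of the post-processor block: read backwards it
is the pairing `⟨1ⁿ, ·⟩`, from which the post-processor learns `n`. [folklore] -/
def vg (n : ℕ) : List Bool := [true, false] ++ List.replicate (2 * n) true

/-- The tableau input length of the post-processor block. [folklore] -/
def nG (n : ℕ) : ℕ := D Q n + (vg n).length

/-- The emptiness wire of cell `j` of the output of `h`. [folklore] -/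
def empW (n j : ℕ) : ℕ := resW Q.eh Q.Mh n j none

/-- The `true`-code wire of cell `i` of the output of `h`. [folklore] -/
def tWh (n i : ℕ) : ℕ := resW Q.eh Q.Mh n i (symTrue Q.Mh)

/-! ### Size bookkeeping -/

/-- `L(n) + 1 = JJ`. [folklore] -/
theorem Lh_succ (n : ℕ) : Lh Q n + 1 = JJ Q.eh Q.Mh n := by
  have := one_le_dd Q.Mh.tm
  unfold Lh JJ; omega

/-- `|vg n| = 2n + 2`. [folklore] -/
@[simp] theorem length_vg (n : ℕ) : (vg n).length = 2 * n + 2 := by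
  simp [vg]

/-- `n ≤ widthH n`. [folklore] -/
theorem le_widthH (n : ℕ) : n ≤ widthH Q n := (le_NN (e := Q.eh) (M := Q.Mh) n).trans (NN_le_width _)

/-- Emptiness wires lie inside the block of `h`. [folklore] -/
theorem empW_lt_widthH {n j : ℕ} (hj : j ≤ Lh Q n) : empW Q n j < widthH Q n :=
  resW_lt_width (by have := Lh_succ Q n; omega) _

/-- `true`-code wires lie inside the block of `h`. [folklore] -/
theorem tWh_lt_widthH {n i : ℕ} (hi : i ≤ Lh Q n) : tWh Q n i < widthH Q n :=
  resW_lt_width (by have := Lh_succ Q n; omega) _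

/-- Data wires are below the emptiness wires. [folklore] -/
theorem lt_empW {n i : ℕ} (hi : i < n) (j : ℕ) : i < empW Q n j :=
  lt_of_lt_of_le hi ((le_NN (e := Q.eh) (M := Q.Mh) n).trans (NN_le_resW _ _ _))

/-- `empW` is injective in the cell. [folklore] -/
theorem empW_injective (n : ℕ) : Injective (empW Q n) := fun _ _ h => (resW_inj h).1

/-- `tWh` is injective in the cell. [folklore] -/
theorem tWh_injective (n : ℕ) : Injective (tWh Q n) := fun _ _ h => (resW_inj h).1

/-- `flagW` is injective. [folklore] -/
theorem flagW_injective (n : ℕ) : Injective (flagW Q n) := fun _ _ h => Nat.add_left_cancel h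

/-- Flags lie below the base of the blocks. [folklore] -/
theorem flagW_lt_baseB {n ℓ : ℕ} (hℓ : ℓ ≤ Lh Q n) : flagW Q n ℓ < baseB Q n := by
  unfold flagW baseB; omega

/-- The front window lies below the base of the blocks. [folklore] -/
theorem Pw_le_baseB (n : ℕ) : Pw Q n ≤ baseB Q n := by unfold baseB; omega

/-- The block of `h` lies below the base of the blocks. [folklore] -/
theorem widthH_lt_baseB (n : ℕ) : widthH Q n < baseB Q n := by unfold baseB; omega

/-- Block wires lie between the base and `D`. [folklore] -/
theorem blockW_lt_D {n ℓ i : ℕ} (hℓ : ℓ ≤ Lh Q n) (hi : i < Pw Q n) : blockW Q n ℓ i < D Q n := by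
  unfold blockW D
  have : ℓ * Pw Q n + Pw Q n ≤ (Lh Q n + 1) * Pw Q n := by
    rw [Nat.succ_mul]; exact Nat.add_le_add_right (Nat.mul_le_mul_right _ hℓ) _
  omega

/-- `baseB ≤ blockW`. [folklore] -/
theorem baseB_le_blockW (n ℓ i : ℕ) : baseB Q n ≤ blockW Q n ℓ i := by unfold blockW; omega

/-- Block wires of one block are injective in the position. [folklore] -/
theorem blockW_injective (n ℓ : ℕ) : Injective (blockW Q n ℓ) := fun i i' h => by unfold blockW at h; omega

/-- Distinct blocks are disjoint (positions below the width). [folklore] -/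
theorem blockW_inj {n ℓ i ℓ' i' : ℕ} (hi : i < Pw Q n) (hi' : i' < Pw Q n) (h : blockW Q n ℓ i = blockW Q n ℓ' i') :
    ℓ = ℓ' ∧ i = i' := by
  unfold blockW at h
  have h2 : ℓ * Pw Q n + i = ℓ' * Pw Q n + i' := by omega
  have hl : ℓ = ℓ' := by
    rcases lt_trichotomy ℓ ℓ' with hlt | heq | hgt
    · have : (ℓ + 1) * Pw Q n ≤ ℓ' * Pw Q n := Nat.mul_le_mul_right _ hlt
      rw [Nat.succ_mul] at this; omega
    · exact heq
    · have : (ℓ' + 1) * Pw Q n ≤ ℓ * Pw Q n := Nat.mul_le_mul_right _ hgt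
      rw [Nat.succ_mul] at this; omega
  subst hl
  exact ⟨rfl, by omega⟩

/-- For `ℓ ≤ L(n)`, `ℓ + F.ancillas ℓ ≤ Pw n` under the ancilla bound (polynomials over `ℕ` are
monotone). [folklore] -/
theorem le_Pw {n ℓ : ℕ} (hℓ : ℓ ≤ Lh Q n) : ℓ + Q.F.ancillas ℓ ≤ Pw Q n := by
  unfold Pw
  have hmono : Q.pF.eval ℓ ≤ Q.pF.eval (Lh Q n) := TM2Iter.eval_mono Q.pF hℓ
  have := Q.hpF ℓ
  omega

/-- **The output of `h` fits**: `|h x| ≤ L(|x|)`. [folklore] -/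
theorem length_h_le_Lh (x : List Bool) : (Q.h x).length ≤ Lh Q x.length := by
  have := (length_lt_JJ_of_outputsWithin (e := Q.eh) rfl (Q.hMh x)).1
  unfold Lh; omega

/-- After the block of `h` on `x 0 0 …`: the emptiness wires read the profile of `h x`.
[folklore] -/
theorem clEval_blockH_empW (x : List Bool) {j : ℕ} (hj : j ≤ Lh Q x.length) :
    clEval (cleanOps Q.eh Q.Mh x.length []) (strW x) (empW Q x.length j) = decide ((Q.h x).length ≤ j) :=
  clEval_cleanOps_nil_none x (Q.h x) (Q.hMh x) (by have := Lh_succ Q x.length; omega)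

/-- After the block of `h` on `x 0 0 …`: the `true`-code wires inside `h x` read its bits.
[folklore] -/
theorem clEval_blockH_tWh (x : List Bool) {i : ℕ} (hi : i < (Q.h x).length) :
    clEval (cleanOps Q.eh Q.Mh x.length []) (strW x) (tWh Q x.length i) = (Q.h x)[i] :=
  clEval_cleanOps_nil_symTrue x (Q.h x) (Q.hMh x) hi

/-- After the block of `h`: data wires keep `x`. [folklore] -/
theorem clEval_blockH_of_lt (x : List Bool) {i : ℕ} (hi : i < x.length) :
    clEval (cleanOps Q.eh Q.Mh x.length []) (strW x) i = x.getD i false := by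
  rw [clEval_cleanOps_nil x (Q.h x) (Q.hMh x)]
  simp [hi]

/-- After the block of `h`: everything from its width on is still `0`. [folklore] -/
theorem clEval_blockH_of_widthH_le (x : List Bool) {i : ℕ} (hi : widthH Q x.length ≤ i) :
    clEval (cleanOps Q.eh Q.Mh x.length []) (strW x) i = false := by
  rw [clEval_cleanOps_nil x (Q.h x) (Q.hMh x)]
  have : ¬ i < x.length := Nat.not_lt.2 ((le_widthH Q x.length).trans hi)
  simp only [this, if_false]
  exact readOut_of_width_le _ hi

/-! ### The wrapped post-processor -/

/-- The live length read off the flags: the position of the first set flag (`|fl|` if none).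
[folklore] -/
def liveLen (fl : List Bool) : ℕ := fl.findIdx (· == true)

/-- **The wrapped post-processor.** On the content `u = d ++ vg n` of the data wires of its block
(`|d| = D n`: the input `x` on the first `n` wires, the flags at `widthH n`, the blocks at
`baseB n`), recover `n` from the suffix, `x`, the live length `ℓ*` from the flags, the content
`y` of the first `ℓ* + F.ancillas ℓ*` wires of block `ℓ*`, and return `g ⟨x, y⟩`.
[cite: BernsteinVazirani1997, §8 (classical computation inside quantum machines)] -/
def gWrap (g : List Bool → List Bool) (u : List Bool) : List Bool :=
  let r := u.reverse
  let n := (boolUnpair r).1.length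
  let d := (boolUnpair r).2.reverse
  let ls := liveLen ((d.drop (widthH Q n)).take (Lh Q n + 1))
  g (boolPair (d.take n) ((d.drop (blockW Q n ls 0)).take (ls + Q.F.ancillas ls)))

/-- **Read backwards, the data followed by the suffix is the pairing `⟨1ⁿ, reversed data⟩`.**
[folklore] -/
theorem reverse_append_vg (d : List Bool) (n : ℕ) :
    (d ++ vg n).reverse = boolPair (List.replicate n true) d.reverse := by
  -- doubling a block of `1`s (cf. `CookLevin.flatMap_dup_replicate`, not imported here)
  have key : ∀ m : ℕ, ((List.replicate m true).flatMap fun b => [b, b]) = List.replicate (2 * m) true := by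
    intro m
    induction m with
    | zero => rfl
    | succ m ih =>
      rw [List.replicate_succ, List.flatMap_cons, ih, show 2 * (m + 1) = 1 + 1 + 2 * m by ring,
        List.replicate_add, List.replicate_add]
      rfl
  simp [vg, boolPair, key, List.reverse_replicate]

/-- **The defining equation of `gWrap` on well-formed inputs.** [folklore] -/
theorem gWrap_apply (g : List Bool → List Bool) (n : ℕ) (d : List Bool) :
    gWrap Q g (d ++ vg n) =
      g (boolPair (d.take n) ((d.drop (blockW Q n (liveLen ((d.drop (widthH Q n)).take (Lh Q n + 1))) 0)).take
        (liveLen ((d.drop (widthH Q n)).take (Lh Q n + 1)) +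
          Q.F.ancillas (liveLen ((d.drop (widthH Q n)).take (Lh Q n + 1)))))) := by
  simp only [gWrap, reverse_append_vg, boolUnpair_boolPair, List.length_replicate, List.reverse_reverse]

/-- On one-hot flags the live length is the position of the set flag. [folklore] -/
theorem liveLen_oneHot {L ls : ℕ} (hls : ls ≤ L) (fl : List Bool) (hlen : fl.length = L + 1)
    (hfl : ∀ ℓ (h : ℓ < fl.length), fl[ℓ] = decide (ℓ = ls)) : liveLen fl = ls := by
  unfold liveLen
  have hls' : ls < fl.length := by omega
  have hex : ∃ b ∈ fl, (fun b : Bool => b == true) b = true :=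
    ⟨fl[ls], List.getElem_mem hls', by simp [hfl ls hls']⟩
  have hlt : fl.findIdx (fun b : Bool => b == true) < fl.length := List.findIdx_lt_length_of_exists hex
  have hget := List.findIdx_getElem (w := hlt)
  rw [hfl _ hlt] at hget
  simpa using hget

end CWrap

end Literature.Computability.QuantumComplexity

end
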